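import Summits.QuantumFields.BalabanUV.T4Continuum.Spine.NE2.DeltaPrimeData

/-!
# T⁴ programme, spine node NE2 (U1a) — THE RATE END FOR PRINT'S (3.26) OPERATOR SHAPE `[principal part] + Q*(U) a Q(U) + Δ′` AT `R = Ad V`, AND ITS NON-VACUITY
# (repair R15 of the census: ROOT B restated in print's vocabulary through the dictionary B0; closes the gen-2 chain AdjointFieldInstance → DictionaryB0 →
# DeltaPrimeOperator → DeltaPrimeCatalogue → DeltaPrimeHodgeRate → DeltaPrimeSecondOrder → DeltaPrimeData → THIS FILE)

Cell `pub-balaban-gaps` (track G2, seat ne2 = spine estimate NE2; census `run/shared/lean/pub/pub-balaban-gaps/ne/NE2.md` §5 R15, §10).  [B9] (3.26) (p. 395) writes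
the background operator as `Δ_a(U) = [D*_U D_U-type principal part, incl. Δ′ of (3.10)] + Q*(U) a Q(U)` with print's adjoint convention `Q* = η^{−d}Qᴴ`
(`B5DeltaA169.QvAdj = L^{kd}·Qᴴ`).  `Spine/NE2/DeltaPrimeData.principalB9_deltaPrime_rate_of_small` gives the tower-limit rate for
`(principalB9 (Ad V_k) (P_k) + a·Q*Q ⊗ 1 + avgPert(Ad V) k + Δ′(V_k))⁻¹`.  THIS FILE (§1) identifies the two averaging summands with print's last term:
**`freeAvg_add_avgPert`** — `a·Q*Q ⊗ 1 + avgPert L M a (liftR R_b) k = a·(L^{kd}·Q(R)ᴴ)·Q(R)` with the model's covariant block averaging `Q(R) = QcovLev (liftR R_b) k`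
(exact; `NE2BalabanRoot.avgPert` unfolds to `a·L^{kd}·(Q(R)ᴴQ(R) − QᴴQ ⊗ 1)`); (§2) restates the END accordingly: **`balaban326_rate_of_small`** —
  `TowerLimitRate (Qlev ⊗ 1) L^d (k ↦ (principalB9 (Ad V_k) (P_k) + a·(L^{kd}·Q(Ad V)_kᴴ)·Q(Ad V)_k + Δ′(V_k))⁻¹) (Cpert (κ_H + κ_{Δ′}) (2dCst) CJ (…) 0 1) L⁻¹`
under `RegularSites (Ad ∘ V) α β β₂`, node NE3's `LocalRate` on `regClass₂ (Ad ∘ V)` BY NAME (OPEN), `α, β ≤ η ≤ etaStar ι d a a′`, the seven data bounds of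
`DeltaPrimeData` (size of `V − 1`; size / block-parent consistency / lattice-Lipschitz of the two plaquette fields) and ONE threshold — NOTHING ELSE; and (§3) proves
the binder set JOINTLY SATISFIABLE: at the flat bond field `V ≡ 1`, `wT_one`/`DqT_one` (readings vanish), **`regularSites_one`** (`RegularSites 1 0 0 0`),
**`localRate_one`** (node NE3's `LocalRate` on `regClass₂ 1`, any `C, θ ≥ 0`), and **`balaban326_rate_one`**: the END's conclusion at `V ≡ 1` with NO
hypothesis (`Ad 1 = 1`; `S(1) = symF 0 = 0`, `B(1) = brkF 0 = 0` by `reHol_one`/`imHol_one`; `η := min(η⋆, 1/(8(d²Cst+1)))`; threshold by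
`NE2BalabanHodge.kappaHodge_lt_one`, `kappaDP d a 0 0 = 0`; constants packaged existentially).
WHAT SEPARATES `balaban326_rate_of_small` FROM NE2 (U1a) AS T4-DAG READS IT (honest ledger, census §4–§6): (r2) the model's covariant averaging `QcovLev` versus
[B7] (15)'s composed `Q(U)` (repair R14, blocked on DIVERGENCE F6); (G2) the hypotheses are ABOUT a data tower `V` — that Bałaban's minimiser satisfies them is
node NE3 + (3.35)–(3.36) (OPEN in the tree); (R7) `m = k` layer uniformity is the tree's `TowerLimitRate` currency; the η-rate itself is never printed.
HONEST FRAMING (T4-DAG p. 1).  Composition BY NAME at MODEL LEVEL; nothing printed is a hypothesis or a conclusion; NE2 (U1a) NOT PROVED; spine PROVED 0/9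
unchanged; NOT continuum YM / infinite volume / mass gap / Clay.  HONEST DEPENDENCY: continuum YM on T⁴ ⇐ BetaPertH ∧ nine spine estimates (0/9 proved);
BetaPertH ⇐ (D1) ∧ (D4) ∧ CAP+tail; G-an2-4 gates asym, D1 and NE2/3/4.  No `sorry`, no `def`.
-/

noncomputable section

open scoped BigOperators ComplexConjugate Matrix


namespace Summit.QuantumFields.BalabanUV.T4Continuum.NE2.PrincipalB9Rate

open scoped Kronecker Matrix.Norms.L2Operator
open Literature.MathematicalPhysics.QuantumFieldTheory.Balaban1983to89.B5Prop11Plancherel (Tor fine shiftM unitVec Cst Cst_nonneg)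
open Literature.MathematicalPhysics.QuantumFieldTheory.Balaban1983to89.B5G183RateUnitTower (lev lev_neZero)
open Literature.MathematicalPhysics.QuantumFieldTheory.Balaban1983to89.T4EtaRateMin (LocalRate)
open Literature.MathematicalPhysics.QuantumFieldTheory.Balaban1983to89.B5Block118 (QvOp)
open Literature.MathematicalPhysics.QuantumFieldTheory.Balaban1983to89.B5DeltaA169 (QvAdj)
open Summit.QuantumFields.BalabanUV.T4Continuum
open Summit.QuantumFields.BalabanUV.T4Continuum.BalabanAveragedTowerUnit (idx Qlev)
open Summit.QuantumFields.BalabanUV.T4Continuum.BalabanAveragedTowerModes (par)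
open Summit.QuantumFields.BalabanUV.T4Continuum.CovariantAveragingTower (TowerLimitRate)
open Summit.QuantumFields.BalabanUV.T4Continuum.CovariantBlockAveraging (QcovLev)
open Summit.QuantumFields.BalabanUV.T4Continuum.BackgroundResolventTower (Cpert)
open Summit.QuantumFields.BalabanUV.T4Continuum.KingPairingPlantedLaw (CJ)
open Summit.QuantumFields.BalabanUV.T4Continuum.NE2FromNE3 (bgReadings)
open Summit.QuantumFields.BalabanUV.T4Continuum.RegularBackgroundTower (betaNE3)
open Summit.QuantumFields.BalabanUV.T4Continuum.HolonomyTowerRegular (RegularSites regClass₂ wT DqT)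
open Summit.QuantumFields.BalabanUV.T4Continuum.GaugeTermScalarData (QuT)
open Summit.QuantumFields.BalabanUV.T4Continuum.RegularSiteTransporters (siteT)
open Summit.QuantumFields.BalabanUV.T4Continuum.NestedContourTransport (theta0)
open Summit.QuantumFields.BalabanUV.T4Continuum.GramPerturbationLaw (C2gram)
open Summit.QuantumFields.BalabanUV.T4Continuum.NE2BalabanRoot (avgPert)
open Summit.QuantumFields.BalabanUV.T4Continuum.NE2BalabanGauge (liftR)
open Summit.QuantumFields.BalabanUV.T4Continuum.NE2BalabanLayerSharp (kappaBs C2Bs)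
open Summit.QuantumFields.BalabanUV.T4Continuum.NE2BalabanWiring (epsR CdeltaR)
open Summit.QuantumFields.BalabanUV.T4Continuum.NE2BalabanFinal (kappa4F C4F)
open Summit.QuantumFields.BalabanUV.T4Continuum.NE2BalabanThreshold (etaStar etaStar_pos)
open Summit.QuantumFields.BalabanUV.T4Continuum.NE2BalabanHodge (kappaHodge_lt_one)
open Summit.QuantumFields.BalabanUV.T4Continuum.NE2.DeltaPrimeHodgeRate (kappaDP2 CDP2)
open Summit.QuantumFields.BalabanUV.T4Continuum.GaugeTermSandwichBound (projP)
open Summit.QuantumFields.BalabanUV.T4Continuum.GaugeTermLayer (Gop)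
open Summit.QuantumFields.BalabanUV.Beta.AdjointCarrierWiringEnd (CompFamily)
open Summit.QuantumFields.BalabanUV.T4Continuum.NE2.AdjointFieldInstance (adRep)
open Summit.QuantumFields.BalabanUV.T4Continuum.NE2.DeltaPrimeOperator
open Summit.QuantumFields.BalabanUV.T4Continuum.NE2.DeltaPrimeCatalogue
open Summit.QuantumFields.BalabanUV.T4Continuum.NE2.DictionaryB0 (principalB9)
open Summit.QuantumFields.BalabanUV.T4Continuum.NE2.DeltaPrimeSecondOrder
open Summit.QuantumFields.BalabanUV.T4Continuum.NE2.DeltaPrimeData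

variable {n : Type} [Fintype n] [DecidableEq n] {d : ℕ} {ι : Type} [Fintype ι] [DecidableEq ι]

/-! ## §1 The averaging term of (3.26): free averaging + the model's averaging perturbation = `Q(R)* a Q(R)` -/

section Averaging

variable (L : ℕ) [NeZero L] (M : Fin d → ℕ) [hM : ∀ μ, NeZero (M μ)] (a : ℝ)

omit [NeZero L] in
/-- **THE AVERAGING TERM IN PRINT'S FORM**: the free averaging term `a·Q*Q ⊗ 1` plus the model's averaging perturbation `avgPert` IS `Q(R)*·a·Q(R)` with the
model's covariant block averaging `Q(R) = QcovLev (liftR R_b)` and print's adjoint convention `Q* = η^{−d}Qᴴ = L^{kd}Qᴴ` (`B5DeltaA169.QvAdj`) — the shape of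
the last term of [B9] (3.26) `Q*(U) a Q(U)` (print's `Q(U)` there is the [B7] (15)-composed averaging; the model's is `QcovLev` — residual r2).  Exact.
[cite: Balaban1985BackgroundPropagators, (3.26) p.395 (shape)] [folklore] -/
theorem freeAvg_add_avgPert (Rb : (k : ℕ) → Fin d → Tor (fine (lev L k) M) → Matrix ι ι ℂ) (k : ℕ) :
    ((a : ℂ) • (QvAdj (lev L k) M * QvOp (lev L k) M)) ⊗ₖ (1 : Matrix ι ι ℂ) + avgPert L M a (liftR L M Rb) k
      = (a : ℂ) • (((((lev L k : ℕ) : ℂ) ^ d) • (QcovLev L M (liftR L M Rb) k)ᴴ) * QcovLev L M (liftR L M Rb) k) := by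
  simp only [avgPert, QvAdj, Matrix.smul_mul, Matrix.smul_kronecker, smul_sub]
  abel

end Averaging

/-! ## §2 The rate END for print's (3.26) operator shape at `R = Ad V` -/

section Rate

variable (L : ℕ) [NeZero L] (M : Fin d → ℕ) [hM : ∀ μ, NeZero (M μ)] (a : ℝ) (ha : 0 < a) {c : ℝ} {e : ι → Matrix n n ℂ}

include ha in
/-- **RATE END FOR PRINT'S (3.26) SHAPE** `Δ_a(U) = [principal part (3.26)] + Q*(U) a Q(U) + Δ′ (3.10)` at `R = Ad V`, the model's covariant averaging in
place of [B7]'s: `DeltaPrimeData.principalB9_deltaPrime_rate_of_small` with the averaging summands rewritten by `freeAvg_add_avgPert`.  Binders as there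
(connection: `RegularSites (Ad ∘ V)`, node NE3's `LocalRate` BY NAME; `Δ′`: the seven data bounds; `α, β ≤ η ≤ etaStar`; ONE threshold) — NOTHING ELSE.
Model level; `V` is DATA; NE3 OPEN; NE2 (U1a) NOT proved by this. [cite: Balaban1985BackgroundPropagators, (3.10) p.392, (3.26) p.395, (3.35)–(3.36) p.397 (shapes)]
[folklore] -/
theorem balaban326_rate_of_small [Nonempty n] [Nonempty ι] {Pc : Submodule ℝ (Matrix n n ℂ)} (hF : CompFamily c Pc e) (hL : 2 ≤ L) (hd : 1 ≤ d)
    (V : (k : ℕ) → Fin d → Tor (fine (lev L k) M) → Matrix.unitaryGroup n ℂ)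
    {α β β₂ : ℝ} (hreg₂ : RegularSites L M (fun k ν x => adRep hF (V k ν x)) α β β₂) {C : ℝ} (hC : 0 ≤ C)
    (hNE3₂ : LocalRate (bgReadings L M (regClass₂ L M (fun k ν x => adRep hF (V k ν x)))) C ((L : ℝ)⁻¹)) {a' : ℝ} (ha' : 0 < a')
    {η : ℝ} (hαη : α ≤ η) (hβη : β ≤ η) (hη : η ≤ etaStar ι d a a')
    {α₁ bS σS σS' bB σB σB' : ℝ} (hα₁ : 0 ≤ α₁) (hbS : 0 ≤ bS) (hσS : 0 ≤ σS) (hσS' : 0 ≤ σS') (hbB : 0 ≤ bB) (hσB : 0 ≤ σB) (hσB' : 0 ≤ σB')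
    (hV1 : ∀ k μ x, ‖(V k μ x : Matrix n n ℂ) - 1‖ ≤ α₁ / (lev L k : ℕ))
    (hSb : ∀ k μ ν x, ‖Sfield (fine (lev L k) M) (lev L k) c e (fun ν x => (V k ν x : Matrix n n ℂ)) μ ν x‖ ≤ bS)
    (hSc : ∀ k μ ν (y : Tor (fine (lev L (k + 1)) M)), ‖Sfield (fine (lev L (k + 1)) M) (lev L (k + 1)) c e (fun ν x => (V (k + 1) ν x : Matrix n n ℂ)) μ ν y
      - Sfield (fine (lev L k) M) (lev L k) c e (fun ν x => (V k ν x : Matrix n n ℂ)) μ ν (par (lev L k) L M y)‖ ≤ σS / (lev L k : ℕ))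
    (hSl : ∀ k μ ν lam (x : Tor (fine (lev L k) M)), ‖Sfield (fine (lev L k) M) (lev L k) c e (fun ν x => (V k ν x : Matrix n n ℂ)) μ ν (x - unitVec _ lam)
      - Sfield (fine (lev L k) M) (lev L k) c e (fun ν x => (V k ν x : Matrix n n ℂ)) μ ν x‖ ≤ σS' / (lev L k : ℕ))
    (hBb : ∀ k μ ν x, ‖Bfield (fine (lev L k) M) (lev L k) c e (fun ν x => (V k ν x : Matrix n n ℂ)) μ ν x‖ ≤ bB)
    (hBc : ∀ k μ ν (y : Tor (fine (lev L (k + 1)) M)), ‖Bfield (fine (lev L (k + 1)) M) (lev L (k + 1)) c e (fun ν x => (V (k + 1) ν x : Matrix n n ℂ)) μ ν y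
      - Bfield (fine (lev L k) M) (lev L k) c e (fun ν x => (V k ν x : Matrix n n ℂ)) μ ν (par (lev L k) L M y)‖ ≤ σB / (lev L k : ℕ))
    (hBl : ∀ k μ ν lam (x : Tor (fine (lev L k) M)), ‖Bfield (fine (lev L k) M) (lev L k) c e (fun ν x => (V k ν x : Matrix n n ℂ)) μ ν (x - unitVec _ lam)
      - Bfield (fine (lev L k) M) (lev L k) c e (fun ν x => (V k ν x : Matrix n n ℂ)) μ ν x‖ ≤ σB' / (lev L k : ℕ))
    (hthr : (kappaBs ι d a α β (a * (epsR ι d α * (2 + epsR ι d α) * Cst d a)) (kappa4F d a a' α β)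
      + (d : ℝ) ^ 2 * ((2 * β + 2 * α ^ 2) * Cst d a)) + kappaDP d a bS bB < 1) :
    TowerLimitRate (fun k => Qlev L M k ⊗ₖ (1 : Matrix ι ι ℂ)) ((L : ℝ) ^ d)
      (fun k => (principalB9 (fine (lev L k) M) ((lev L k : ℕ) : ℂ) (fun ν x => adRep hF (V k ν x))
          (projP (fine (lev L k) M) (Gop L M (fun k ν x => adRep hF (V k ν x)) (QuT L M ι (siteT L M (fun k ν x => adRep hF (V k ν x)))) a' k)
            (QuT L M ι (siteT L M (fun k ν x => adRep hF (V k ν x))) k))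
        + (a : ℂ) • (((((lev L k : ℕ) : ℂ) ^ d) • (QcovLev L M (liftR L M (fun k ν x => adRep hF (V k ν x))) k)ᴴ)
            * QcovLev L M (liftR L M (fun k ν x => adRep hF (V k ν x))) k)
        + deltaPrime (fine (lev L k) M) (lev L k) c e (fun ν x => (V k ν x : Matrix n n ℂ)))⁻¹)
      (Cpert ((kappaBs ι d a α β (a * (epsR ι d α * (2 + epsR ι d α) * Cst d a)) (kappa4F d a a' α β)
          + (d : ℝ) ^ 2 * ((2 * β + 2 * α ^ 2) * Cst d a)) + kappaDP d a bS bB) (2 * d * Cst d a) (CJ d a)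
        ((C2Bs ι d L a α β (betaNE3 ι C + β₂)
            (a * C2gram (Cst d a) 1 (epsR ι d α) (2 * d * Cst d a) (CJ d a) (Cst d a)
              (CdeltaR ι d a α (theta0 d α (betaNE3 ι (betaNE3 ι C + β₂)))))
            (C4F ι d L a a' α β (betaNE3 ι C + β₂))
          + (d : ℝ) ^ 2 * (Cst d a * ((2 * β + 2 * α ^ 2) * (2 * Cst d a) + (2 * (betaNE3 ι C + β₂) + 4 * α * (betaNE3 ι C + β)) * Cst d a)))
          + CDP d a bS (bS * (4 * α₁) + (σS + σS') + bS * (4 * α₁)) bB (bB * (4 * α₁) + (σB + σB') + bB * (4 * α₁)))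
        0 1) ((L : ℝ)⁻¹) := by
  convert principalB9_deltaPrime_rate_of_small L M a ha hF hL hd V hreg₂ hC hNE3₂ ha' hαη hβη hη hα₁ hbS hσS hσS' hbB hσB hσB'
    hV1 hSb hSc hSl hBb hBc hBl hthr using 3 with k
  rw [← freeAvg_add_avgPert L M a (fun k ν x => adRep hF (V k ν x)) k]
  abel

end Rate

/-! ## §3 Non-vacuity: at the flat bond field `V ≡ 1` every displayed binder is discharged -/

section Flat

variable (L : ℕ) [NeZero L] (M : Fin d → ℕ) [hM : ∀ μ, NeZero (M μ)]

omit [Fintype ι] [NeZero L] hM in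
/-- at `R_b ≡ 1` the connection readings vanish. [folklore] -/
theorem wT_one : wT L M (fun (k : ℕ) (_ : Fin d) (_ : Tor (fine (lev L k) M)) => (1 : Matrix ι ι ℂ)) = fun _ _ _ => 0 := by
  funext k ν i; simp [wT]

omit [Fintype ι] [NeZero L] hM in
/-- at `R_b ≡ 1` the difference quotients vanish. [folklore] -/
theorem DqT_one (lam : Fin d) : DqT L M (fun (k : ℕ) (_ : Fin d) (_ : Tor (fine (lev L k) M)) => (1 : Matrix ι ι ℂ)) lam = fun _ _ _ => 0 := by
  funext k ν i; simp [DqT, wT]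

omit [NeZero L] hM in
/-- **`RegularSites` HOLDS AT `R_b ≡ 1`** with `α = β = β₂ = 0`. [folklore] -/
theorem regularSites_one : RegularSites L M (fun (k : ℕ) (_ : Fin d) (_ : Tor (fine (lev L k) M)) => (1 : Matrix ι ι ℂ)) 0 0 0 where
  nonneg := ⟨le_rfl, le_rfl, le_rfl⟩
  size k ν i := by simp [wT]
  lipschitz k ν lam i := by simp [wT]
  lipschitz₂ k lam ν ρ i := by simp [DqT, wT]

omit [Fintype ι] [NeZero L] hM in
/-- **NODE NE3's `LocalRate` HOLDS AT `R_b ≡ 1`** (the class `regClass₂ 1` consists of zero towers). [folklore] -/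
theorem localRate_one {C θ : ℝ} (hC : 0 ≤ C) (hθ : 0 ≤ θ) :
    LocalRate (bgReadings L M (regClass₂ L M (fun (k : ℕ) (_ : Fin d) (_ : Tor (fine (lev L k) M)) => (1 : Matrix ι ι ℂ)))) C θ := by
  intro k W hW s
  change W ∈ regClass₂ L M _ at hW
  rw [regClass₂, wT_one, Set.mem_insert_iff, Set.mem_range] at hW
  have hW0 : W = fun _ _ _ => 0 := by
    rcases hW with h | ⟨lam, h⟩
    · exact h
    · rw [← h, DqT_one]
  subst hW0
  simp only [bgReadings, NE2FromNE3.entryAt, Complex.zero_re, Complex.zero_im, ite_self, sub_self, abs_zero, Matrix.zero_apply]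
  positivity

variable (a : ℝ) (ha : 0 < a) {c : ℝ} {e : ι → Matrix n n ℂ}

include ha in
/-- **NON-VACUITY OF THE (3.26)-SHAPE END.** At the flat bond-field tower `V ≡ 1` every displayed binder of `balaban326_rate_of_small` is DISCHARGED:
`RegularSites (Ad 1 = 1) 0 0 0` (`regularSites_one`), node NE3's `LocalRate` with `C = 0` (`localRate_one`), the seven data bounds with all constants `0`
(`‖1 − 1‖ = 0`; `S(1) = symF(0) = 0`, `B(1) = brkF(0) = 0` by `reHol_one`/`imHol_one`), `η := min(η⋆, 1/(8(d²Cst+1))) ≥ 0`, and the threshold by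
`NE2BalabanHodge.kappaHodge_lt_one` (`kappaDP d a 0 0 = 0`) — so the END's conclusion holds with NO hypothesis at `V ≡ 1` (constants existentially packaged).
The binder set is jointly satisfiable; nothing about non-trivial backgrounds; NE2 NOT proved. [folklore] -/
theorem balaban326_rate_one [Nonempty n] [Nonempty ι] {Pc : Submodule ℝ (Matrix n n ℂ)} (hF : CompFamily c Pc e) (hL : 2 ≤ L) (hd : 1 ≤ d)
    {a' : ℝ} (ha' : 0 < a') :
    ∃ K C₂ : ℝ, TowerLimitRate (fun k => Qlev L M k ⊗ₖ (1 : Matrix ι ι ℂ)) ((L : ℝ) ^ d)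
      (fun k => (principalB9 (fine (lev L k) M) ((lev L k : ℕ) : ℂ) (fun _ _ => adRep hF 1)
          (projP (fine (lev L k) M) (Gop L M (fun _ _ _ => adRep hF 1) (QuT L M ι (siteT L M (fun _ _ _ => adRep hF 1))) a' k)
            (QuT L M ι (siteT L M (fun _ _ _ => adRep hF 1)) k))
        + (a : ℂ) • (((((lev L k : ℕ) : ℂ) ^ d) • (QcovLev L M (liftR L M (fun _ _ _ => adRep hF 1)) k)ᴴ)
            * QcovLev L M (liftR L M (fun _ _ _ => adRep hF 1)) k)
        + deltaPrime (fine (lev L k) M) (lev L k) c e (fun _ _ => ((1 : Matrix.unitaryGroup n ℂ) : Matrix n n ℂ)))⁻¹)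
      (Cpert K (2 * d * Cst d a) (CJ d a) C₂ 0 1) ((L : ℝ)⁻¹) := by
  have hηs := etaStar_pos (o := ι) (d := d) a ha.le ha'.le
  have hCst := Cst_nonneg d a
  obtain ⟨η, hη0, hη1, hη2⟩ : ∃ η : ℝ, 0 ≤ η ∧ η ≤ etaStar ι d a a' ∧ η ≤ 1 / (8 * ((d : ℝ) ^ 2 * Cst d a + 1)) :=
    ⟨min (etaStar ι d a a') (1 / (8 * ((d : ℝ) ^ 2 * Cst d a + 1))), le_min hηs.le (by positivity), min_le_left _ _, min_le_right _ _⟩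
  have h1 : adRep hF (1 : Matrix.unitaryGroup n ℂ) = 1 := map_one _
  have hthr : (kappaBs ι d a 0 0 (a * (epsR ι d 0 * (2 + epsR ι d 0) * Cst d a)) (kappa4F d a a' 0 0)
      + (d : ℝ) ^ 2 * ((2 * 0 + 2 * 0 ^ 2) * Cst d a)) + kappaDP d a 0 0 < 1 := by
    have h := kappaHodge_lt_one (o := ι) (d := d) a ha.le ha' le_rfl le_rfl hη0 hη0 hη1 hη2
    rw [norm_one, one_mul] at h
    have h0 : kappaDP d a 0 0 = 0 := by simp [kappaDP, kappaDP2]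
    linarith
  refine ⟨_, _, balaban326_rate_of_small L M a ha hF hL hd (fun _ _ _ => (1 : Matrix.unitaryGroup n ℂ)) (α := 0) (β := 0) (β₂ := 0)
    ?_ le_rfl (C := 0) ?_ ha' hη0 hη0 hη1 (α₁ := 0) (bS := 0) (σS := 0) (σS' := 0) (bB := 0) (σB := 0) (σB' := 0)
    le_rfl le_rfl le_rfl le_rfl le_rfl le_rfl le_rfl ?_ ?_ ?_ ?_ ?_ ?_ ?_ hthr⟩
  · simp only [h1]; exact regularSites_one L M
  · simp only [h1]; exact localRate_one L M le_rfl (inv_nonneg.mpr (Nat.cast_nonneg _))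
  · intro k μ x; simp
  · intro k μ ν x; simp [Sfield]
  · intro k μ ν y; simp [Sfield]
  · intro k μ ν lam x; simp [Sfield]
  · intro k μ ν x; simp [Bfield]
  · intro k μ ν y; simp [Bfield]
  · intro k μ ν lam x; simp [Bfield]

end Flat

end Summit.QuantumFields.BalabanUV.T4Continuum.NE2.PrincipalB9Rate


end
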